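import Mathlib
import HarnessLib
import Summits.HubbardSuperconductivity.HubbardSuperconductivity.Theorems.KLProgrammeLatticeSoftBubbleSharpZS
import Summits.HubbardSuperconductivity.HubbardSuperconductivity.Theorems.KLProgrammeMatsubaraSlicePropagatorPath

/-!
# Route `KLProgramme` — ENGINE item stmt-HubbardSuperconductivity-20437 `KLRegimeEngineV17F2`, class-#5 STEP (X).3 pinned pair «88b» /
# located-risk #14, factor (γ)-TR: the SOFT slice bubble on the lattice with the sharp zero-sound term AND the path Lipschitz constant of the cut partner
# `K′ = (3ℓ′ + 512M_f′)/Λ²` (cell gate-hubbard-kl, seat hubbard-kl-k3c2-p2 g22, technique «thermal-bar induction n ≤ nScales β + 1 with EngineBoundsAtV4S sums»)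

Text-faithful twin (suffix `T`) of `klfl_lattice_soft_bubble_norm_leS` (…LatticeSoftBubbleSharpZS) with the cut partner's joint Lipschitz constant taken from
`klfp_prop_cutWeight_lipschitz_path` (…MatsubaraSlicePropagatorPath): `(65ℓ′ + 17408M_f′/3)/Λ²` becomes `(3ℓ′ + 512M_f′)/Λ²` in the transfer and lattice pieces
(at the pinned pair, `j = n+2`: `14123 ↦ 896`, a factor `2^3.98`); every other term and hypothesis unchanged.
Pure analysis on the tree's objects; nothing about the model is asserted; nothing asserts (X).3, (c), K3 or superconductivity.
References: BGM 2006 §2.4–2.5 [cite: BenfattoGiulianiMastropietro2006]; FST 1998 App. B [cite: FeldmanSalmhoferTrubowitz1998].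
-/


noncomputable section

namespace Summit.HubbardSuperconductivity.HubbardSuperconductivity.Theorems.KLRegimeSplit

set_option linter.dupNamespace false -- summit = problem name (single-conjunct summit), D-0017

open Real Set Filter MeasureTheory Complex Literature.MathematicalPhysics.QuantumLattice Literature.Probability.LatticeModels
open Literature.MathematicalPhysics.QuantumLattice.BandSectorCounting
open Summit.HubbardSuperconductivity.HubbardSuperconductivity.Theorems.PerturbedFermiCurve
open Summit.HubbardSuperconductivity.HubbardSuperconductivity.Theorems.KLProgrammeLegKernels

section Soft

variable {a' b' : ℝ} (B : BandBounds a' b') {δ : (Fin 2 → ℝ) → ℝ} (hδ1 : ContDiff ℝ 1 δ) {κ₀ κ₁ : ℝ}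
  (hδ : ∀ k : Fin 2 → ℝ, (∀ i, |k i| ≤ π) → |δ k| ≤ κ₀)
  (hκ : ∀ k : Fin 2 → ℝ, (∀ i, |k i| ≤ π) → ‖fderiv ℝ δ k‖ ≤ κ₁) (hκ₁ : κ₁ < B.Dtmin)


include B hδ1 hδ hκ hκ₁ in
/-- **THE FORWARD SLICE BUBBLE ON THE MODEL CARRIER WITH A SOFT PARTNER** (second weight `f'` Lipschitz `≤ ℓ'/Λ_n²`, bounded `M_f'`, NO support
hypothesis at all — e.g. `d_n = 1 − χ₂(s/Λ_n²)`), below resolution: `|q₀| ≤ Λ_n/8`, `|ẽ' − ẽ| ≤ δ_max ≤ Λ_n/8` everywhere.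
Conclusion = `klfl_lattice_forward_bubble_norm_le_of_lipschitzS` at the PATH constant `K′ = (3ℓ' + 512M_f')/Λ_n²` (`klfp_prop_cutWeight_lipschitz_path`), `M′ = 16M_f'/Λ_n`, sharp zero-sound term. -/
theorem klfl_lattice_soft_bubble_norm_leT
    {κ₂ : ℝ} (hκ₂ : 0 ≤ κ₂)
    (hD2 : ∀ θ s t : ℝ, s ∈ Icc 0 (π / ‖dir θ‖) → t ∈ Icc 0 (π / ‖dir θ‖) →
      |fderiv ℝ δ (s • dir θ) (dir θ) - fderiv ℝ δ (t • dir θ) (dir θ)| ≤ κ₂ * |s - t|)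
    {a : ℝ × ℝ → ℂ} (ha : Continuous a) (ha1 : ∀ x y, a (x + 2 * π, y) = a (x, y)) (ha2 : ∀ x y, a (x, y + 2 * π) = a (x, y))
    {A₀ La : ℝ} (hA0 : ∀ p, ‖a p‖ ≤ A₀) (hLa : ∀ p q, ‖a p - a q‖ ≤ La * dist p q)
    {eb : ℝ × ℝ → ℝ} (hebc : Continuous eb) (heb1 : ∀ x y, eb (x + 2 * π, y) = eb (x, y)) (heb2 : ∀ x y, eb (x, y + 2 * π) = eb (x, y))
    {Le : ℝ} (hLe : ∀ p q, |eb p - eb q| ≤ Le * dist p q) {μ : ℝ} (heb : ∀ p ∈ Icc (-π) π ×ˢ Icc (-π) π, eb p = klfb_band δ μ p)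
    {eb' : ℝ × ℝ → ℝ} (heb'c : Continuous eb') (heb'1 : ∀ x y, eb' (x + 2 * π, y) = eb' (x, y)) (heb'2 : ∀ x y, eb' (x, y + 2 * π) = eb' (x, y))
    {Le' : ℝ} (hLe' : ∀ p q, |eb' p - eb' q| ≤ Le' * dist p q) {δmax : ℝ} (hδ0 : 0 ≤ δmax) {n : ℕ}
    (hδmax : δmax ≤ klScale klE0 n / 8) (hshift : ∀ p : ℝ × ℝ, |eb' p - eb p| ≤ δmax)
    {zm : ℝ} (hzm : 0 < zm)
    (hzone : ∀ p ∈ Icc (-π) π ×ˢ Icc (-π) π, |eb p| < 4 * klScale klE0 n → |p.1| ≤ π - 2 * zm ∧ |p.2| ≤ π - 2 * zm)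
    {f f' : ℝ → ℂ} {Lf Mf ℓf Lf' Mf' ℓ' LF MF ℓ : ℝ}
    (hlip : ∀ s s', ‖f s - f s'‖ ≤ Lf * |s - s'|) (hbd : ∀ s, ‖f s‖ ≤ Mf) (hLf : Lf ≤ ℓf / klScale klE0 n ^ 2)
    (hin : ∀ s, s ≤ (klScale klE0 n / 2) ^ 2 → f s = 0) (hout : ∀ s, (4 * klScale klE0 n) ^ 2 ≤ s → f s = 0)
    (hlip' : ∀ s s', ‖f' s - f' s'‖ ≤ Lf' * |s - s'|) (hbd' : ∀ s, ‖f' s‖ ≤ Mf') (hLf' : Lf' ≤ ℓ' / klScale klE0 n ^ 2)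
    (hMF : 0 ≤ MF) (hFlip : ∀ s s', ‖f s * f' s - f s' * f' s'‖ ≤ LF * |s - s'|) (hFbd : ∀ s, ‖f s * f' s‖ ≤ MF)
    (hLF : LF ≤ ℓ / klScale klE0 n ^ 2)
    (hlo : a' < μ - 4 * klScale klE0 n - κ₀) (hhi : μ + 4 * klScale klE0 n + κ₀ < b')
    {q₀ : ℝ} (hq₀ : |q₀| ≤ klScale klE0 n / 8) {β : ℝ} (hβ : klBetaMin ≤ β) (hn : n ≤ nScales β + 1) {M : ℕ}
    (hM : β * (4 * klScale klE0 n) / (2 * Real.pi) + 1 ≤ M) (L : ℕ) [NeZero L] :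
    ‖β⁻¹ • ∑ i : MatsubaraIdx M, ((L ^ 2 : ℕ) : ℝ)⁻¹ • ∑ k : TorusSite 2 L,
        a (latticeMomentum L k 0, latticeMomentum L k 1) *
          klfb_prop f (matsubaraFreq β M i) (eb (latticeMomentum L k 0, latticeMomentum L k 1)) *
            klfb_prop f' (matsubaraFreq β M i + q₀) (eb' (latticeMomentum L k 0, latticeMomentum L k 1))‖ ≤
      ((2 * π) ^ 2)⁻¹ *
          (2 * Real.pi *
            (64 / Real.pi * MF *
                (Real.pi * Real.sqrt 2 / (B.Dtmin - κ₁) * (La + A₀ * (2 / zm)) / (B.Dtmin - κ₁) +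
                  A₀ * (1 / (B.Dtmin - κ₁) ^ 2 + Real.pi * Real.sqrt 2 * (2 + κ₂) / (B.Dtmin - κ₁) ^ 3)) * klScale klE0 n +
              393216 / Real.pi * (ℓ + 8 * MF) * (A₀ * (Real.pi * Real.sqrt 2 / (B.Dtmin - κ₁))) * ((Real.pi / β) / klScale klE0 n) +
              256 / Real.pi * Mf * (A₀ * (Real.pi * Real.sqrt 2 / (B.Dtmin - κ₁))) *
                ((3 * ℓ' + 512 * Mf') / klScale klE0 n ^ 2 * klScale klE0 n) * (|q₀| + δmax))) +
        32 * klScale klE0 n *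
            (La * (2 * Mf / klScale klE0 n) * (16 * Mf' / klScale klE0 n) +
              A₀ * ((9 * ℓf + 4 * Mf) / klScale klE0 n ^ 2 * Le) * (16 * Mf' / klScale klE0 n) +
              A₀ * (2 * Mf / klScale klE0 n) * ((3 * ℓ' + 512 * Mf') / klScale klE0 n ^ 2 * Le')) / L := by
  have hΛ := klth_klScale_pos n
  have hMf' : 0 ≤ Mf' := (norm_nonneg _).trans (hbd' 0)
  have hLf'0 : 0 ≤ Lf' := by have := hlip' 0 1; norm_num at this; linarith [norm_nonneg (f' 0 - f' 1)]
  have hℓ' : 0 ≤ ℓ' := by have h := hLf'0.trans hLf'; rwa [le_div_iff₀ (by positivity), zero_mul] at h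
  -- the shifted band against the frame band on the open square
  have he'δ : ∀ p : ℝ × ℝ, |p.1| < π → |p.2| < π → |eb' p - klfb_band δ μ p| ≤ δmax := by
    intro p h1 h2
    rw [← heb p ⟨⟨(abs_lt.mp h1).1.le, (abs_lt.mp h1).2.le⟩, ⟨(abs_lt.mp h2).1.le, (abs_lt.mp h2).2.le⟩⟩]
    exact hshift p
  -- cut the second weight
  have hcut : ∀ (i : MatsubaraIdx M) (k : TorusSite 2 L),
      a (latticeMomentum L k 0, latticeMomentum L k 1) *
          klfb_prop f (matsubaraFreq β M i) (eb (latticeMomentum L k 0, latticeMomentum L k 1)) *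
            klfb_prop f' (matsubaraFreq β M i + q₀) (eb' (latticeMomentum L k 0, latticeMomentum L k 1)) =
        a (latticeMomentum L k 0, latticeMomentum L k 1) *
          klfb_prop f (matsubaraFreq β M i) (eb (latticeMomentum L k 0, latticeMomentum L k 1)) *
            klfb_prop (fun s => f' s * (klfp_cut (klScale klE0 n) s : ℂ)) (matsubaraFreq β M i + q₀)
              (eb' (latticeMomentum L k 0, latticeMomentum L k 1)) :=
    fun i k => klfl_summand_cut_eq hin hq₀ ((hshift _).trans hδmax)
  simp_rw [hcut]
  have hK' : 0 ≤ (3 * ℓ' + 512 * Mf') / klScale klE0 n ^ 2 := by positivity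
  have hFlip'' : ∀ s s', ‖f s * (f' s * (klfp_cut (klScale klE0 n) s : ℂ)) - f s' * (f' s' * (klfp_cut (klScale klE0 n) s' : ℂ))‖ ≤
      LF * |s - s'| := fun s s' => by rw [klfp_mul_cutWeight_eq hin s, klfp_mul_cutWeight_eq hin s']; exact hFlip s s'
  have hFbd'' : ∀ s, ‖f s * (f' s * (klfp_cut (klScale klE0 n) s : ℂ))‖ ≤ MF := fun s => by
    rw [klfp_mul_cutWeight_eq hin s]; exact hFbd s
  exact klfl_lattice_forward_bubble_norm_le_of_lipschitzS B hδ1 hδ hκ hκ₁ hκ₂ hD2 ha ha1 ha2 hA0 hLa hebc heb1 heb2 hLe heb heb'c heb'1 heb'2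
    hLe' hδ0 he'δ hzm hzone hlip hbd hLf hin hout hK' (klfp_prop_cutWeight_lipschitz_path hlip' hbd' hLf')
    (klfl_prop_cutWeight_norm_le hbd') hMF hFlip'' hFbd'' hLF hlo hhi q₀ hβ hn hM L


end Soft

end Summit.HubbardSuperconductivity.HubbardSuperconductivity.Theorems.KLRegimeSplit

end
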